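import Summits.AtomisticToContinuum.Crystallization.Theorems.FreeSplittingCertificatesStrictSplittingRuleDefs
import Literature.MathematicalPhysics.StatisticalMechanics.LennardJonesClusters
import Literature.MathematicalPhysics.StatisticalMechanics.LennardJonesThermodynamicLimitProofs

/-!
# `StrictSplittingRule` (stmt-AtomisticToContinuum-12560), line `birth`: stub `stub_deficitBound` (S2a)

The FREE half of the perturbative certificate of the line `birth` of the crux `StrictSplittingRule`
(route `FreeSplittingCertificates`): a uniform deficit bound, valid for EVERY pair-splitting rule `Φ`
(`IsRule Φ`: box `0 ≤ Φ ≤ 1` + complementarity) and every reading radius `R`, on `δ`-separated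
configurations (`Sep δ x`):

* `stub_deficitBound : ∀ δ > 0, ∃ D ≥ 0, ∀ R Φ, IsRule Φ → ∀ N x, Sep δ x → ∀ k, eInf - D ≤ siteE R Φ x k`.

Proof (explicit constant `D = (250/6) δ⁻⁶`):

1. `eInf ≤ 0` (`deficitBound_eInf_nonpos`): Fekete's constant `eInf = ⨅_M E(M+1)/(M+1)` is a
   conditionally complete infimum over a family bounded below (by the thermodynamic limit `e_∞`,
   `BlancLewin2015_8_holds` at `d = 3`), so `eInf ≤ E(1)/1 = 0` (`groundStateEnergy_of_le_one`).
2. Termwise (`deficitBound_term`): for a weight `0 ≤ w ≤ 1`,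
   `w · V_LJ(r) + (1/6) r⁻⁶ = (1/12) w r⁻¹² + (1/6)(1 - w) r⁻⁶ ≥ 0`.
3. Summing over `j ≠ k` and using the shell sum `∑_{j ≠ k} |x_k - x_j|⁻⁶ ≤ 250 δ⁻⁶`
   (`sum_inv_pow_six_le`) gives `siteE R Φ x k ≥ -(250/6) δ⁻⁶ ≥ eInf - D`.

Sources: X. Blanc, M. Lewin, *The crystallization conjecture: a review*, EMS Surv. Math. Sci. 2 (2015),
§1.3 (8) (thermodynamic limit, here only `e_∞ ≤ E(N)/N`); the shell-sum packing bound is folklore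
(tree: `LennardJonesClusters.sum_inv_pow_six_le`).
-/

noncomputable section

namespace Summit.AtomisticToContinuum.Crystallization.Theorems.StrictSplittingRuleBirth

open scoped BigOperators Classical
open Literature.MathematicalPhysics.StatisticalMechanics

/-- Euclidean `3`-space. -/
local notation "E3" => EuclideanSpace ℝ (Fin 3)

/-- Fekete's constant is nonpositive: `eInf ≤ E(1)/1 = 0`, the infimum being over a family bounded
below by the thermodynamic limit `e_∞` (`BlancLewin2015_8_holds` at `d = 3`). [folklore] -/
theorem deficitBound_eInf_nonpos : eInf ≤ 0 := by
  obtain ⟨e, -, -, he⟩ := BlancLewin2015_8_holds 3 (by norm_num) (by norm_num)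
  have hbdd : BddBelow (Set.range fun M : ℕ =>
      groundStateEnergy lennardJones 3 (M + 1) / ((M + 1 : ℕ) : ℝ)) := by
    refine ⟨e, ?_⟩
    rintro _ ⟨M, rfl⟩
    exact he (M + 1) M.succ_pos
  have h := ciInf_le hbdd 0
  have h1 : groundStateEnergy lennardJones 3 (0 + 1) / ((0 + 1 : ℕ) : ℝ) = 0 := by
    rw [groundStateEnergy_of_le_one lennardJones (by norm_num), zero_div]
  unfold eInf
  exact h.trans_eq h1

/-- Termwise bound: a bond carrying a weight `0 ≤ w ≤ 1` contributes at least the attractive tail,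
`-(1/6) r⁻⁶ ≤ w · V_LJ(r)`, since `w · V_LJ(r) + (1/6) r⁻⁶ = (1/12) w r⁻¹² + (1/6)(1 - w) r⁻⁶ ≥ 0`.
[folklore] -/
theorem deficitBound_term {w : ℝ} (r : ℝ) (hw0 : 0 ≤ w) (hw1 : w ≤ 1) :
    -((1 / 6) * (r⁻¹) ^ 6) ≤ w * lennardJones r := by
  have hu : 0 ≤ (r⁻¹) ^ 6 := by positivity
  have h12 : (r⁻¹) ^ 12 = ((r⁻¹) ^ 6) ^ 2 := by ring
  unfold lennardJones
  rw [h12]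
  nlinarith [mul_nonneg hw0 (sq_nonneg ((r⁻¹) ^ 6)), mul_nonneg hu (sub_nonneg.2 hw1)]

/-- **S2a** uniform deficit bound for every rule on `δ`-separated configurations: for every hard core
`δ > 0` there is `D ≥ 0` (here `D = (250/6) δ⁻⁶`) such that for every reading radius `R`, every
pair-splitting rule `Φ` (box + complementarity), every `δ`-separated finite configuration `x` and every
site `k`, the weighted site energy satisfies `eInf - D ≤ siteE R Φ x k` (only the box constraint
`0 ≤ Φ ≤ 1`, the attractive tail `-(1/6) r⁻⁶ ≤ w V_LJ(r)` and the shell sum `sum_inv_pow_six_le` are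
used, together with `eInf ≤ 0`). [folklore] -/
theorem stub_deficitBound : ∀ δ : ℝ, 0 < δ → ∃ D : ℝ, 0 ≤ D ∧ ∀ (R : ℝ) (Φ : E3 → Finset E3 → ℝ),
    IsRule Φ → ∀ (N : ℕ) (x : Fin N → E3), Sep δ x → ∀ k : Fin N, eInf - D ≤ siteE R Φ x k := by
  intro δ hδ
  refine ⟨250 / 6 * δ⁻¹ ^ 6, by positivity, ?_⟩
  intro R Φ hΦ N x hsep k
  have h0 : eInf ≤ 0 := deficitBound_eInf_nonpos
  have hsum : ∑ j ∈ Finset.univ.erase k, (dist (x k) (x j))⁻¹ ^ 6 ≤ 250 * δ⁻¹ ^ 6 :=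
    sum_inv_pow_six_le x hδ hsep k
  unfold siteE
  calc eInf - 250 / 6 * δ⁻¹ ^ 6
      ≤ -((1 / 6) * ∑ j ∈ Finset.univ.erase k, (dist (x k) (x j))⁻¹ ^ 6) := by linarith
    _ = ∑ j ∈ Finset.univ.erase k, -((1 / 6) * (dist (x k) (x j))⁻¹ ^ 6) := by
        rw [Finset.mul_sum, ← Finset.sum_neg_distrib]
    _ ≤ _ := Finset.sum_le_sum fun j _ => deficitBound_term _ (hΦ.1 _ _).1 (hΦ.1 _ _).2

end Summit.AtomisticToContinuum.Crystallization.Theorems.StrictSplittingRuleBirth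

end
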